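import Mathlib
import HarnessLib
import Literature.Analysis.FluidPDE.BoundedAnnihilator
import Summits.NavierStokesRegularity.NavierStokesRegularity.Theorems.PoloidalWindowDoorLrcModEntireTwistingTHPoincareLemma

/-!
# Item `LrcModEntire` (stmt-NavierStokesRegularity-20428), skeleton twist_split v6 — T1 cell, step (I), JET stub: THE PLANAR ENDGAME
# («lowest jets ⇒ bad data»: from the planar jet data at the flat thread plane to the hypotheses of `…TwistingTHBadDataNoGo.noBadData`)

Cell ns-regularity-ideate, seat ns-k2-port-2 g4 (free hand; `--supports stmt-NavierStokesRegularity-20428 --as helper`).  Sub-step (E) of `stub_flatPlane_badData`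
(LEAD ns-poloidal-K2-p3 g13, `Cruxes/LrcModEntire/T1StepI.lean`, dossier CELLS-TH-g13 §2bis «CLAIM (I)»), CLASS-FREE: the z-jet analysis (Z)(S)(T) of the slice
`v(−1,·)` at the flat thread plane `P₀ = ℝ²` delivers PLANAR DATA

* `a' = a⁽ᵏ⁰⁻²⁾ : ℝ² → ℝ²` of class `C³`, curl-free, `div a' = −b`, bounded (`‖a'‖ ≤ G`)   [(S) at order `k₀ − 2`, (F1)];
* `b = b_{k₀} : ℝ² → ℝ`, `b ≤ 0`, `b ≢ 0`, `|b| ≤ B`   [(Z): first non-vanishing `z`-jet of `v₂`, even order, sign pin; (F1)];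
* `a = a⁽ʲ¹⁾ : ℝ² → ℝ²` of class `C¹`, `a ≢ 0`, with EITHER `a = a'` (case `j₁ = k₀ − 2`) OR `div a = 0` (case `j₁ < k₀ − 2`)   [(S) at order `j₁`];
* the leading order of the global bilinear (TH) identity: `aᵢ(x)·∂ₗb(x') = aₗ(x')·∂ᵢb(x)` for all `x, x' ∈ ℝ²`, `i, l`   [(T)],

and this file turns them into the «BAD DATA» `Φ ∈ C³(ℝ³)`, `‖∇Φ‖ ≤ G'`, `ΔΦ ≥ 0`, `ΔΦ ≢ 0`, [`∇ΔΦ` constant ∨ `∇Φ = −μ₀∇ΔΦ`] refuted by `noBadData`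
(`Φ` = the `x₂`-independent extension of the Poincaré potential `φ` of `a'`, `Δφ = −b`; dichotomy: `∇b ≡ 0` ⇒ first branch; else `∂ₗb(x₁) ≠ 0` and (T) give
`a = μ₀∇b` — in case `a = a'` this is the second branch, in case `div a = 0` it makes the bounded `b` HARMONIC, hence constant (Liouville,
`InnerProductSpace.HarmonicOnNhd.apply_eq_apply_of_abs_le`), contradicting `∂ₗb(x₁) ≠ 0`).

Main theorem: `badData_of_planarJets` (conclusion = the `∃ Φ …` of `stub_flatPlane_badData` VERBATIM).

WHAT THIS IS NOT: not a claim about Navier–Stokes regularity; the jet bookkeeping (Z)(S)(T)(F1) producing the planar data from the class is NOT done here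
(bears_on LADDER-NS N0, item 20428 / crux 19708; both OPEN).
-/

noncomputable section

-- the summit and its single sub-problem share the name (CONVENTIONS §1), as in every Theorems file
set_option linter.dupNamespace false

namespace Summit.NavierStokesRegularity.NavierStokesRegularity.Theorems.PoloidalWindowDoorLrcModEntireTwistingTHJetEndgame

open Set Function Filter Topology InnerProductSpace
open scoped RealInnerProductSpace InnerProductSpace Laplacian Topology
open Summit.NavierStokesRegularity.NavierStokesRegularity.Theorems.PoloidalWindowDoorLrcModEntireTwistingTHPoincareLemma

/-! ### Planar coordinate bookkeeping -/

/-- Expansion of a planar vector along the standard basis. -/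
theorem planar_expand (h : EuclideanSpace ℝ (Fin 2)) : h = h 0 • EuclideanSpace.single 0 (1:ℝ) + h 1 • EuclideanSpace.single 1 (1:ℝ) := by
  ext i
  fin_cases i <;> simp

/-- A linear functional on `ℝ²` in coordinates. -/
theorem clm_apply_expand (T : EuclideanSpace ℝ (Fin 2) →L[ℝ] ℝ) (h : EuclideanSpace ℝ (Fin 2)) :
    T h = h 0 * T (EuclideanSpace.single 0 1) + h 1 * T (EuclideanSpace.single 1 1) := by
  conv_lhs => rw [planar_expand h]
  simp only [map_add, map_smul, smul_eq_mul]

/-- The planar inner product in coordinates. -/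
theorem inner_expand (a h : EuclideanSpace ℝ (Fin 2)) : ⟪a, h⟫_ℝ = a 0 * h 0 + a 1 * h 1 := by
  conv_lhs => rw [planar_expand h]
  simp only [inner_add_right, real_inner_smul_right, EuclideanSpace.inner_single_right]
  simp
  ring

/-- A linear functional on `ℝ²` vanishing on the basis vanishes. -/
theorem clm_eq_zero_of_basis {T : EuclideanSpace ℝ (Fin 2) →L[ℝ] ℝ} (h0 : T (EuclideanSpace.single 0 1) = 0) (h1 : T (EuclideanSpace.single 1 1) = 0) :
    T = 0 := by
  ext h
  rw [clm_apply_expand, h0, h1]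
  simp

/-- `D(x ↦ Df(x)u)(x)w = D²f(x)(w)(u)` for `f ∈ C²`. -/
theorem fderiv_fderiv_apply {E : Type*} [NormedAddCommGroup E] [NormedSpace ℝ E] {f : E → ℝ} (hf : ContDiff ℝ 2 f) (x u w : E) :
    fderiv ℝ (fun y => fderiv ℝ f y u) x w = fderiv ℝ (fderiv ℝ f) x w u := by
  have hd : DifferentiableAt ℝ (fderiv ℝ f) x := ((hf.fderiv_right (m := 1) le_rfl).differentiable one_ne_zero) x
  rw [fderiv_clm_apply hd (differentiableAt_const _)]
  simp

/-- **The planar Laplacian in coordinates**: `Δf = ∂₀(∂₀f) + ∂₁(∂₁f)` for `f ∈ C²(ℝ²)`. -/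
theorem laplacian_planar {f : EuclideanSpace ℝ (Fin 2) → ℝ} (hf : ContDiff ℝ 2 f) (x : EuclideanSpace ℝ (Fin 2)) :
    (Δ f) x = fderiv ℝ (fun y => fderiv ℝ f y (EuclideanSpace.single 0 1)) x (EuclideanSpace.single 0 1) +
      fderiv ℝ (fun y => fderiv ℝ f y (EuclideanSpace.single 1 1)) x (EuclideanSpace.single 1 1) := by
  rw [laplacian_eq_iteratedFDeriv_orthonormalBasis f (EuclideanSpace.basisFun (Fin 2) ℝ)]
  simp only [Fin.sum_univ_two, EuclideanSpace.basisFun_apply, iteratedFDeriv_two_apply, Matrix.cons_val_zero, Matrix.cons_val_one,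
    fderiv_fderiv_apply hf]

/-- The coordinate of a derivative: `D(x ↦ a(x)ᵢ)(x)h = (Da(x)h)ᵢ`. -/
theorem fderiv_coord_apply {E : Type*} [NormedAddCommGroup E] [NormedSpace ℝ E] {n : ℕ} {a : E → EuclideanSpace ℝ (Fin n)} {x : E}
    (ha : DifferentiableAt ℝ a x) (i : Fin n) (h : E) :
    fderiv ℝ (fun y => a y i) x h = fderiv ℝ a x h i := by
  have hc := ((EuclideanSpace.proj (𝕜 := ℝ) i).hasFDerivAt.comp x ha.hasFDerivAt).fderiv
  rw [show (fun y => a y i) = (EuclideanSpace.proj (𝕜 := ℝ) i) ∘ a from rfl, hc]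
  rfl

/-! ### The Poincaré potential of the divergence datum -/

/-- From `a' ∈ C³(ℝ², ℝ²)` curl-free with `div a' = −b`: a potential `φ ∈ C⁴`, `Dφ(x)h = ⟪a'(x), h⟫`, `Δφ = −b`; and `b ∈ C²`. -/
theorem exists_planarPotential {a' : EuclideanSpace ℝ (Fin 2) → EuclideanSpace ℝ (Fin 2)} {b : EuclideanSpace ℝ (Fin 2) → ℝ} (ha' : ContDiff ℝ 3 a')
    (hcurl' : ∀ x, fderiv ℝ a' x (EuclideanSpace.single 0 1) 1 = fderiv ℝ a' x (EuclideanSpace.single 1 1) 0)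
    (hdiv' : ∀ x, fderiv ℝ a' x (EuclideanSpace.single 0 1) 0 + fderiv ℝ a' x (EuclideanSpace.single 1 1) 1 = -b x) :
    ContDiff ℝ 2 b ∧ ∃ φ : EuclideanSpace ℝ (Fin 2) → ℝ, ContDiff ℝ 4 φ ∧ (∀ x h, fderiv ℝ φ x h = ⟪a' x, h⟫_ℝ) ∧ ∀ x, (Δ φ) x = -b x := by
  have hD : ContDiff ℝ 2 (fderiv ℝ a') := ha'.fderiv_right (m := 2) (by norm_cast)
  have hb_eq : b = fun x => -(fderiv ℝ a' x (EuclideanSpace.single 0 1) 0 + fderiv ℝ a' x (EuclideanSpace.single 1 1) 1) := by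
    funext x; rw [hdiv' x]; ring
  have hcoord : ∀ (u : EuclideanSpace ℝ (Fin 2)) (i : Fin 2), ContDiff ℝ 2 fun x => fderiv ℝ a' x u i := fun u i =>
    (contDiff_piLp_apply (p := 2) (n := 2) (i := i) (E := fun _ : Fin 2 => ℝ) (𝕜 := ℝ)).comp (hD.clm_apply contDiff_const)
  have hbC : ContDiff ℝ 2 b := by
    rw [hb_eq]
    exact ((hcoord _ 0).add (hcoord _ 1)).neg
  refine ⟨hbC, ?_⟩
  obtain ⟨φ, hφ, hDφ, hDφi⟩ := exists_potential_of_planar_curlFree (n := 3) (by norm_num) ha' hcurl'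
  refine ⟨φ, by exact_mod_cast hφ, hDφ, fun x => ?_⟩
  have hφ2 : ContDiff ℝ 2 φ := hφ.of_le (by norm_cast)
  have had : Differentiable ℝ a' := ha'.differentiable (by norm_cast)
  rw [laplacian_planar hφ2]
  have e : ∀ i : Fin 2, (fun y => fderiv ℝ φ y (EuclideanSpace.single i 1)) = fun y => a' y i := fun i => funext fun y => hDφi y i
  rw [e 0, e 1, fderiv_coord_apply (had x) 0, fderiv_coord_apply (had x) 1, ← hdiv' x]

/-! ### Lifting planar functions to `ℝ³` (independent of `x₂`) -/

/-- The `x₂`-forgetting projection `ℝ³ → ℝ²` as a continuous linear map, with its action on coordinates and on the standard basis. -/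
theorem exists_planarProjection :
    ∃ P : EuclideanSpace ℝ (Fin 3) →L[ℝ] EuclideanSpace ℝ (Fin 2), (∀ x i, P x i = x (Fin.castSucc i)) ∧
      P (EuclideanSpace.single 0 1) = EuclideanSpace.single 0 1 ∧ P (EuclideanSpace.single 1 1) = EuclideanSpace.single 1 1 ∧
      P (EuclideanSpace.single 2 1) = 0 ∧ ∀ x' : EuclideanSpace ℝ (Fin 2), ∃ x : EuclideanSpace ℝ (Fin 3), P x = x' := by
  set P : EuclideanSpace ℝ (Fin 3) →L[ℝ] EuclideanSpace ℝ (Fin 2) :=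
    (EuclideanSpace.equiv (Fin 2) ℝ).symm.toContinuousLinearMap.comp
      (ContinuousLinearMap.pi fun i : Fin 2 => EuclideanSpace.proj (𝕜 := ℝ) (Fin.castSucc i : Fin 3)) with hPdef
  have hP : ∀ x i, P x i = x (Fin.castSucc i) := fun x i => by simp [hPdef]
  refine ⟨P, hP, ?_, ?_, ?_, fun x' => ?_⟩
  · ext i; rw [hP]; fin_cases i <;> simp
  · ext i; rw [hP]; fin_cases i <;> simp
  · ext i; rw [hP]; fin_cases i <;> simp [Fin.ext_iff]
  · refine ⟨(EuclideanSpace.equiv (Fin 3) ℝ).symm ![x' 0, x' 1, 0], ?_⟩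
    ext i; rw [hP]; fin_cases i <;> simp

/-- **Lift**: for `φ ∈ C²(ℝ²)` and the projection `P`, `Φ := φ ∘ P` has `DΦ(x) = Dφ(Px) ∘ P` and `ΔΦ(x) = Δφ(Px)`. -/
theorem laplacian_lift {φ : EuclideanSpace ℝ (Fin 2) → ℝ} (hφ : ContDiff ℝ 2 φ) {P : EuclideanSpace ℝ (Fin 3) →L[ℝ] EuclideanSpace ℝ (Fin 2)}
    (hP0 : P (EuclideanSpace.single 0 1) = EuclideanSpace.single 0 1) (hP1 : P (EuclideanSpace.single 1 1) = EuclideanSpace.single 1 1)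
    (hP2 : P (EuclideanSpace.single 2 1) = 0) (x : EuclideanSpace ℝ (Fin 3)) :
    (Δ (fun y => φ (P y))) x = (Δ φ) (P x) := by
  rw [laplacian_eq_iteratedFDeriv_orthonormalBasis (fun y => φ (P y)) (EuclideanSpace.basisFun (Fin 3) ℝ),
    laplacian_eq_iteratedFDeriv_orthonormalBasis φ (EuclideanSpace.basisFun (Fin 2) ℝ)]
  have hc : ∀ m : Fin 2 → EuclideanSpace ℝ (Fin 3), iteratedFDeriv ℝ 2 (fun y => φ (P y)) x m = iteratedFDeriv ℝ 2 φ (P x) (fun i => P (m i)) := by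
    intro m
    rw [show (fun y => φ (P y)) = φ ∘ P from rfl, P.iteratedFDeriv_comp_right hφ x (i := 2) (by norm_cast)]
    rfl
  simp only [Fin.sum_univ_three, Fin.sum_univ_two, EuclideanSpace.basisFun_apply, hc]
  have hm : ∀ v : EuclideanSpace ℝ (Fin 3), (fun i : Fin 2 => P (![v, v] i)) = ![P v, P v] := by
    intro v; funext i; fin_cases i <;> rfl
  rw [hm, hm, hm, hP0, hP1, hP2]
  have hz : iteratedFDeriv ℝ 2 φ (P x) ![(0 : EuclideanSpace ℝ (Fin 2)), 0] = 0 :=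
    (iteratedFDeriv ℝ 2 φ (P x)).map_coord_zero 0 rfl
  rw [hz, add_zero]

/-! ### The planar dichotomy from the leading-order (TH) identity -/

/-- From `aᵢ(x)∂ₗb(x') = aₗ(x')∂ᵢb(x)`: either `∇b ≡ 0`, or `a = μ₀∇b` for a constant `μ₀` (and some `∂ₗb(x₁) ≠ 0`). -/
theorem dichotomy_of_TH {a : EuclideanSpace ℝ (Fin 2) → EuclideanSpace ℝ (Fin 2)} {b : EuclideanSpace ℝ (Fin 2) → ℝ}
    (hTH : ∀ (x x' : EuclideanSpace ℝ (Fin 2)) (i l : Fin 2),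
      a x i * fderiv ℝ b x' (EuclideanSpace.single l 1) = a x' l * fderiv ℝ b x (EuclideanSpace.single i 1)) :
    (∀ x, fderiv ℝ b x = 0) ∨
      ∃ μ₀ : ℝ, (∃ x₁ l, fderiv ℝ b x₁ (EuclideanSpace.single l 1) ≠ 0) ∧ ∀ x i, a x i = μ₀ * fderiv ℝ b x (EuclideanSpace.single i 1) := by
  by_cases hgrad : ∀ x (l : Fin 2), fderiv ℝ b x (EuclideanSpace.single l 1) = 0
  · exact Or.inl fun x => clm_eq_zero_of_basis (hgrad x 0) (hgrad x 1)
  · push Not at hgrad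
    obtain ⟨x₁, l, hl⟩ := hgrad
    refine Or.inr ⟨a x₁ l / fderiv ℝ b x₁ (EuclideanSpace.single l 1), ⟨x₁, l, hl⟩, fun x i => ?_⟩
    have h := hTH x x₁ i l
    field_simp
    linarith [h]

/-- **Case `div a = 0` is impossible when `∇b ≢ 0`**: `a = μ₀∇b`, `a ≢ 0`, `div a = 0`, `b ∈ C²` bounded ⇒ `b` is a bounded HARMONIC function on `ℝ²`,
hence constant — contradicting `∂ₗb(x₁) ≠ 0`. -/
theorem false_of_divFree_branch {a : EuclideanSpace ℝ (Fin 2) → EuclideanSpace ℝ (Fin 2)} {b : EuclideanSpace ℝ (Fin 2) → ℝ} {μ₀ B : ℝ}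
    (ha : ContDiff ℝ 1 a) (hane : ∃ x, a x ≠ 0) (hdiv : ∀ x, fderiv ℝ a x (EuclideanSpace.single 0 1) 0 + fderiv ℝ a x (EuclideanSpace.single 1 1) 1 = 0)
    (hbC : ContDiff ℝ 2 b) (hB : ∀ x, |b x| ≤ B) (hrel : ∀ x i, a x i = μ₀ * fderiv ℝ b x (EuclideanSpace.single i 1))
    {x₁ : EuclideanSpace ℝ (Fin 2)} {l : Fin 2} (hl : fderiv ℝ b x₁ (EuclideanSpace.single l 1) ≠ 0) : False := by
  -- `μ₀ ≠ 0`
  have hμ : μ₀ ≠ 0 := by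
    rintro rfl
    obtain ⟨x, hx⟩ := hane
    exact hx (by ext i; rw [hrel x i]; simp)
  -- `∂ᵢ b = μ₀⁻¹ aᵢ`, so `Δ b = μ₀⁻¹ div a = 0`
  have hgrad : ∀ i : Fin 2, (fun y => fderiv ℝ b y (EuclideanSpace.single i 1)) = fun y => μ₀⁻¹ * a y i := by
    intro i; funext y; rw [hrel y i]; field_simp
  have had : Differentiable ℝ a := ha.differentiable (by simp)
  have hΔ : ∀ x, (Δ b) x = 0 := by
    intro x
    rw [laplacian_planar hbC, hgrad 0, hgrad 1]
    have e : ∀ i : Fin 2, fderiv ℝ (fun y => μ₀⁻¹ * a y i) x (EuclideanSpace.single i 1) = μ₀⁻¹ * fderiv ℝ a x (EuclideanSpace.single i 1) i := by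
      intro i
      have hdi : DifferentiableAt ℝ (fun y => a y i) x := (EuclideanSpace.proj (𝕜 := ℝ) i).differentiableAt.comp x (had x)
      rw [show (fun y => μ₀⁻¹ * a y i) = fun y => μ₀⁻¹ • a y i from rfl, fderiv_fun_const_smul hdi, smul_apply,
        fderiv_coord_apply (had x) i, smul_eq_mul]
    rw [e 0, e 1, ← mul_add, hdiv x, mul_zero]
  -- `b` is harmonic and bounded on `ℝ²`, hence constant
  have hharm : HarmonicOnNhd b (univ : Set (EuclideanSpace ℝ (Fin 2))) := fun x _ =>
    ⟨hbC.contDiffAt, Filter.Eventually.of_forall fun y => by simp [hΔ y]⟩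
  have hconst : ∀ y, b y = b 0 := fun y => hharm.apply_eq_apply_of_abs_le hB y 0
  have hb0 : b = fun _ => b 0 := funext hconst
  apply hl
  rw [hb0]
  simp

/-! ### The endgame -/

/-- **LOWEST JETS ⇒ BAD DATA.**  Planar data `a', b, a` as in the module docstring ((S)(Z)(T)(F1) at the flat thread plane) produce the «bad data» refuted by
`…TwistingTHBadDataNoGo.noBadData`: the conclusion is the `∃ Φ …` of `stub_flatPlane_badData` (`Cruxes/LrcModEntire/T1StepI.lean`) VERBATIM. -/
theorem badData_of_planarJets {a a' : EuclideanSpace ℝ (Fin 2) → EuclideanSpace ℝ (Fin 2)} {b : EuclideanSpace ℝ (Fin 2) → ℝ} {G B : ℝ}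
    (ha' : ContDiff ℝ 3 a')
    (hcurl' : ∀ x, fderiv ℝ a' x (EuclideanSpace.single 0 1) 1 = fderiv ℝ a' x (EuclideanSpace.single 1 1) 0)
    (hdiv' : ∀ x, fderiv ℝ a' x (EuclideanSpace.single 0 1) 0 + fderiv ℝ a' x (EuclideanSpace.single 1 1) 1 = -b x)
    (hG : ∀ x, ‖a' x‖ ≤ G) (hb_le : ∀ x, b x ≤ 0) (hb_ne : ∃ x, b x ≠ 0) (hB : ∀ x, |b x| ≤ B)
    (ha : ContDiff ℝ 1 a) (hane : ∃ x, a x ≠ 0)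
    (hlink : a = a' ∨ ∀ x, fderiv ℝ a x (EuclideanSpace.single 0 1) 0 + fderiv ℝ a x (EuclideanSpace.single 1 1) 1 = 0)
    (hTH : ∀ (x x' : EuclideanSpace ℝ (Fin 2)) (i l : Fin 2),
      a x i * fderiv ℝ b x' (EuclideanSpace.single l 1) = a x' l * fderiv ℝ b x (EuclideanSpace.single i 1)) :
    ∃ Φ : EuclideanSpace ℝ (Fin 3) → ℝ, ContDiff ℝ 3 Φ ∧ (∃ G : ℝ, ∀ x, ‖fderiv ℝ Φ x‖ ≤ G) ∧ (∀ x, 0 ≤ (Δ Φ) x) ∧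
      (∃ x, (Δ Φ) x ≠ 0) ∧
      ((∃ L : EuclideanSpace ℝ (Fin 3) →L[ℝ] ℝ, ∀ x, fderiv ℝ (Δ Φ) x = L) ∨
        (∃ μ₀ : ℝ, ∀ x, fderiv ℝ Φ x = (-μ₀) • fderiv ℝ (Δ Φ) x)) := by
  obtain ⟨hbC, φ, hφ, hDφ, hΔφ⟩ := exists_planarPotential ha' hcurl' hdiv'
  obtain ⟨P, hP, hP0, hP1, hP2, hsurj⟩ := exists_planarProjection
  have hφ2 : ContDiff ℝ 2 φ := hφ.of_le (by norm_cast)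
  have hφd : Differentiable ℝ φ := hφ.differentiable (by norm_cast)
  have hbd : Differentiable ℝ b := hbC.differentiable (by norm_cast)
  -- the lift `Φ = φ ∘ P`
  have hΦC : ContDiff ℝ 3 (fun y => φ (P y)) := (hφ.of_le (by norm_cast)).comp P.contDiff
  have hDΦ : ∀ x, fderiv ℝ (fun y => φ (P y)) x = (fderiv ℝ φ (P x)).comp P := fun x =>
    ((hφd (P x)).hasFDerivAt.comp x P.hasFDerivAt).fderiv
  have hΔΦ : (Δ (fun y => φ (P y))) = fun x => -b (P x) := by
    funext x; rw [laplacian_lift hφ2 hP0 hP1 hP2, hΔφ]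
  have hDΔΦ : ∀ x, fderiv ℝ (Δ (fun y => φ (P y))) x = -((fderiv ℝ b (P x)).comp P) := by
    intro x
    rw [hΔΦ]
    have h1 : fderiv ℝ (fun y => b (P y)) x = (fderiv ℝ b (P x)).comp P := ((hbd (P x)).hasFDerivAt.comp x P.hasFDerivAt).fderiv
    rw [show (fun x => -b (P x)) = fun x => -((fun y => b (P y)) x) from rfl, fderiv_fun_neg, h1]
  -- gradient bound: `‖Dφ(y)‖ = ‖a'(y)‖ ≤ G`
  have hnormφ : ∀ y, ‖fderiv ℝ φ y‖ ≤ G := by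
    intro y
    have e : fderiv ℝ φ y = innerSL ℝ (a' y) := by ext h; rw [hDφ, innerSL_apply_apply]
    rw [e, innerSL_apply_norm]
    exact hG y
  refine ⟨fun y => φ (P y), hΦC, ⟨G * ‖P‖, fun x => ?_⟩, fun x => ?_, ?_, ?_⟩
  · rw [hDΦ]
    exact (ContinuousLinearMap.opNorm_comp_le _ _).trans (mul_le_mul_of_nonneg_right (hnormφ _) (norm_nonneg _))
  · rw [hΔΦ]; simp only; linarith [hb_le (P x)]
  · obtain ⟨x', hx'⟩ := hb_ne
    obtain ⟨x, hx⟩ := hsurj x'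
    exact ⟨x, by rw [hΔΦ]; simp only; rw [hx]; simpa using hx'⟩
  -- the dichotomy
  rcases dichotomy_of_TH hTH with hzero | ⟨μ₀, ⟨x₁, l, hl⟩, hrel⟩
  · refine Or.inl ⟨0, fun x => ?_⟩
    rw [hDΔΦ, hzero]
    simp
  · rcases hlink with rfl | hdiv
    · -- `a = a' = ∇φ = μ₀∇b = −μ₀∇(Δφ)`
      refine Or.inr ⟨μ₀, fun x => ?_⟩
      have e : fderiv ℝ φ (P x) = μ₀ • fderiv ℝ b (P x) := by
        ext h
        rw [hDφ, smul_apply, inner_expand, clm_apply_expand (fderiv ℝ b (P x)) h, hrel (P x) 0, hrel (P x) 1,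
          smul_eq_mul]
        ring
      rw [hDΦ, hDΔΦ, e]
      ext h
      simp
    · exact (false_of_divFree_branch ha hane hdiv hbC hB hrel hl).elim

end Summit.NavierStokesRegularity.NavierStokesRegularity.Theorems.PoloidalWindowDoorLrcModEntireTwistingTHJetEndgame
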